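import Summits.QuantumFields.BalabanUV.Beta.GAN24.WilsonEdgeCurrent
import Summits.QuantumFields.BalabanUV.Beta.GAN24.WilsonVertexTwoConst
import Summits.QuantumFields.BalabanUV.Beta.GAN24.PeriodicCellPairing

/-!
# `BalabanUV.Beta.GAN24.WilsonFaceHalfVertex` — binder row G-an2-4 ∕ (CONV-C), W-slot CT-W, conservation law (C)∕(C)sym, step (P5)(II-b) of this lineage's note
# `HOME/b2b-balaban-gan24-formalise-leaf-04/g65/CSYM-LEVEL0-KERNEL-BLUEPRINT.md`: **THE BIWEIGHTED PAIR `tsum` OF THE CUBIC WILSON TABLE (weights on the table site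
# and on one leg, the other leg free) IS `∓½·curvAdj (p ⊗ q)` — THE EDGE CURRENT OF `GAN24.WilsonEdgeCurrent` IN THE PAIR-`HasSum` CURRENCY OF THE READ-OUT FILES**

NOT IN PRINT; OUR BOOKKEEPING ([folklore] finite-support bookkeeping BY NAME over this lineage's g64 `GAN24.WilsonEdgeCurrent.sum_box1_biweighted_wilsonA_at` + g64
`GAN24.PeriodicCellPairing.edgeCurrent_eq_neg_half_curvAdj`, leaf-19's `GAN24.WilsonVertexTwoConst.wilsonA_eq_zero_of_table_right` and leaf-15's
`GAN24.WilsonVertexSumZero.suppW_subset_box ∕ wilsonA_eq_zero_left` (ultra-locality of an3's table), and the leg antisymmetry of an2's `StepJetData.wilsonA` (by `rfl` on its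
definition `½·(w(x,α;z,β) − w(z,β;x,α))`); G-an2-4 formalisation swarm, leaf prover `b2b-balaban-gan24-formalise-leaf-04`, gen 65).  HONEST FRAMING (cell contract, verbatim):
«discharging `BetaPertH` makes Bałaban's UV stability UNCONDITIONAL — a real constructive-QFT result; it is NOT the continuum limit and NOT the Clay problem.»  HONEST DEPENDENCY
(verbatim): «continuum YM on T⁴ ⇐ BetaPertH ∧ nine spine estimates (0/9 proved); BetaPertH ⇐ (D1) ∧ (D4) ∧ CAP+tail; G-an2-4 gates asym, D1 and NE2/3/4.»

WHY (blueprint §1 (II)): the sibling `GAN24.DressedHalfVertex.hasSum_vertexOfK_dressedStep` puts the FACE indicator `p = 𝟙[· % Lc = Lc−1]` on the background slot of the cubic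
table; the two-face read-out `GAN24.DressedStepFaceCharges.hasSum_mmRead_K3OfK_dressedStep` puts `q = 𝟙[· % Lc = Lc−1]` on one leg; THIS FILE evaluates the resulting pair
sum for the pure Wilson table: it is the EDGE CURRENT `−½·curvAdj (p ⊗ q)` when the weight sits on the FIRST leg and `+½·curvAdj (p ⊗ q)` when it sits on the SECOND (leg
antisymmetry — the «`tR = −tL`» of note g64 §3 (c)) — i.e. exactly the block-periodic current `J` whose resolvent response and exchange pairing are
`GAN24.PeriodicKKTResponseFlux.card_mul_curv_resp_add_half_eq` and `GAN24.PeriodicKKTExchangePairing.card_mul_pairing_plaq`.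

WHAT ([folklore]; generic `d`; 0 `def`, 0 cited facts, 0 `def … : Prop`, 0 sorry): §1 **`hasSum_pair_wilsonA_right`** (any weight `F`, second leg `z` fixed: the pair family
`(t, w) ↦ F t w·wilsonA d γ t w z (inl a)(inl b)` has the `HasSum` `Σ_{x,w′ ∈ box1} F (z−w′) (z−w′+x)·wilsonA d γ (z−w′) (z−w′+x) z (inl a)(inl b)`); §2 (`γ ≠ α`, all `p q : ℤ → ℝ`)
**`hasSum_biweighted_wilsonA`** (`Σ'_{(t,w)} p(t_γ)q(w_α)·wilsonA d γ t w z (inl α)(inl b) = [b=γ]p(z_γ)(q(z_α−1) − q(z_α)) + [b=α]q(z_α)(p(z_γ) − p(z_γ−1))`),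
**`hasSum_biweighted_wilsonA_curvAdj`** (`= −½·curvAdj (p ⊗ q) b z`), **`hasSum_biweighted_wilsonA_snd`** (weight on the SECOND leg, first leg free: `= +½·curvAdj (p ⊗ q) b z`).
Asserts NO value of Bałaban's tables beyond an3's DEFINED stencil; discharges NOTHING of (C)sym ∕ (Q-D) ∕ (Q-D-rate) ∕ «T2Shape» ∕ «T2Drift» ∕ (hW, hWall); NEVER «G-an2-4
closed» as (CONV-C); NOT D1, NOT `BetaPertH`, NOT continuum, NOT Clay.  2026-08-22; no existing file touched.
-/

noncomputable section

open Finset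
open scoped BigOperators
open Literature.MathematicalPhysics.QuantumFieldTheory.Balaban1983to89
open Literature.MathematicalPhysics.QuantumFieldTheory.Balaban1983to89.Beta
open StepJetData (wilsonA)
open BalabanStepJets (box1 mem_box1)
open OneStepResolventKernel (Fib)
open ExpKernelCalculus (Site)
open AffineAveraging (curvAdj)
open Summit.QuantumFields.BalabanUV.Beta.GAN24.WilsonVertexSumZero (suppW suppW_subset_box wilsonA_eq_zero_left)
open Summit.QuantumFields.BalabanUV.Beta.GAN24.WilsonVertexTwoConst (wilsonA_eq_zero_of_table_right)
open Summit.QuantumFields.BalabanUV.Beta.GAN24.WilsonEdgeCurrent (sum_box1_biweighted_wilsonA_at)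
open Summit.QuantumFields.BalabanUV.Beta.GAN24.PeriodicCellPairing (edgeCurrent_eq_neg_half_curvAdj)

namespace Summit.QuantumFields.BalabanUV.Beta.GAN24.WilsonFaceHalfVertex

variable {d : ℕ}

/-! ## §1 The pair sum over (table site, first leg) with the second leg fixed is a finite box sum -/

/-- [folklore] **THE WEIGHTED PAIR SUM OF THE CUBIC WILSON TABLE OVER (TABLE SITE, FIRST LEG), SECOND LEG FIXED, IS THE `box1²` SUM** of
`WilsonEdgeCurrent.sum_box1_biweighted_wilsonA_at`'s parametrisation (table site `z − w′`, first leg `z − w′ + x`, `x w′ ∈ {−1,0,1}^{d+1}`): the table is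
ultra-local (`WilsonVertexTwoConst.wilsonA_eq_zero_of_table_right`, `WilsonVertexSumZero.suppW_subset_box ∕ wilsonA_eq_zero_left`). -/
theorem hasSum_pair_wilsonA_right (γ : Fin (d + 1)) (F : Site (d + 1) → Site (d + 1) → ℝ) (z : Site (d + 1)) (a b : Fin (d + 1)) :
    HasSum (fun tw : Site (d + 1) × Site (d + 1) => F tw.1 tw.2 * wilsonA d γ tw.1 tw.2 z (Sum.inl a) (Sum.inl b))
      (∑ x ∈ box1 (d + 1), ∑ w' ∈ box1 (d + 1), F (z - w') (z - w' + x) * wilsonA d γ (z - w') (z - w' + x) z (Sum.inl a) (Sum.inl b)) := by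
  classical
  set φ : Site (d + 1) × Site (d + 1) → Site (d + 1) × Site (d + 1) := fun p => (z - p.2, z - p.2 + p.1) with hφ
  have hinj : Set.InjOn φ ↑(box1 (d + 1) ×ˢ box1 (d + 1)) := by
    intro p _ p' _ h
    simp only [hφ, Prod.mk.injEq] at h
    obtain ⟨h1, h2⟩ := h
    have e2 : p.2 = p'.2 := by
      have := congrArg (fun v => z - v) h1
      simpa using this
    have e1 : p.1 = p'.1 := by
      rw [e2] at h2
      exact add_left_cancel h2
    exact Prod.ext e1 e2
  have hsupp : ∀ tw ∉ (box1 (d + 1) ×ˢ box1 (d + 1)).image φ, F tw.1 tw.2 * wilsonA d γ tw.1 tw.2 z (Sum.inl a) (Sum.inl b) = 0 := by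
    intro tw htw
    by_contra hne
    have hW : wilsonA d γ tw.1 tw.2 z (Sum.inl a) (Sum.inl b) ≠ 0 := right_ne_zero_of_mul hne
    have ht : tw.1 ∈ (box1 (d + 1)).image fun v => z - v := by
      by_contra ht
      exact hW (wilsonA_eq_zero_of_table_right γ tw.2 ht a b)
    have hw : tw.2 ∈ suppW γ tw.1 := by
      by_contra hw
      exact hW (wilsonA_eq_zero_left γ tw.1 hw z a b)
    obtain ⟨w', hw', hw'e⟩ := Finset.mem_image.1 ht
    obtain ⟨x, hx, hxe⟩ := Finset.mem_image.1 (suppW_subset_box γ tw.1 hw)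
    apply htw
    refine Finset.mem_image.2 ⟨(x, w'), Finset.mem_product.2 ⟨hx, hw'⟩, ?_⟩
    simp only [hφ]
    rw [hw'e, hxe]
  have hsum : ∑ tw ∈ (box1 (d + 1) ×ˢ box1 (d + 1)).image φ, F tw.1 tw.2 * wilsonA d γ tw.1 tw.2 z (Sum.inl a) (Sum.inl b) =
      ∑ x ∈ box1 (d + 1), ∑ w' ∈ box1 (d + 1), F (z - w') (z - w' + x) * wilsonA d γ (z - w') (z - w' + x) z (Sum.inl a) (Sum.inl b) := by
    rw [Finset.sum_image hinj, Finset.sum_product]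
  rw [← hsum]
  exact hasSum_sum_of_ne_finset_zero hsupp

/-! ## §2 The face-weighted pair sum with weights on (table site, first leg): the edge current -/

section Current

variable {γ α : Fin (d + 1)} (hγα : γ ≠ α)
include hγα

/-- [folklore] **THE BIWEIGHTED PAIR `tsum` OF THE CUBIC WILSON TABLE IS THE EDGE CURRENT** (weights `p` on the table site's `γ`-coordinate and `q` on the FIRST leg's
`α`-coordinate, second leg `(b, z)` free; `γ ≠ α`, all `p q : ℤ → ℝ`): `Σ'_{(t,w)} p(t_γ)·q(w_α)·wilsonA d γ t w z (inl α) (inl b) = [b = γ]·p(z_γ)(q(z_α − 1) − q(z_α)) +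
[b = α]·q(z_α)(p(z_γ) − p(z_γ − 1))` — `WilsonEdgeCurrent.sum_box1_biweighted_wilsonA_at` in the pair-`HasSum` currency of the read-out files. -/
theorem hasSum_biweighted_wilsonA (p q : ℤ → ℝ) (b : Fin (d + 1)) (z : Site (d + 1)) :
    HasSum (fun tw : Site (d + 1) × Site (d + 1) => p (tw.1 γ) * q (tw.2 α) * wilsonA d γ tw.1 tw.2 z (Sum.inl α) (Sum.inl b))
      ((if b = γ then p (z γ) * (q (z α - 1) - q (z α)) else 0) + (if b = α then q (z α) * (p (z γ) - p (z γ - 1)) else 0)) := by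
  have h := hasSum_pair_wilsonA_right (d := d) γ (fun t w => p (t γ) * q (w α)) z α b
  rwa [sum_box1_biweighted_wilsonA_at hγα p q b z] at h

/-- [folklore] **… = `−½·curvAdj (p ⊗ q)`** (`PeriodicCellPairing.edgeCurrent_eq_neg_half_curvAdj`): the biweighted pair sum is minus one half of the co-differential of
the plaquette column `F κ l x = [κ = γ][l = α]·p(x_γ)q(x_α) − [κ = α][l = γ]·p(x_γ)q(x_α)` — the CURRENT of `PeriodicKKTResponseFlux` ∕ `PeriodicKKTExchangePairing`. -/
theorem hasSum_biweighted_wilsonA_curvAdj (p q : ℤ → ℝ) (b : Fin (d + 1)) (z : Site (d + 1)) :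
    HasSum (fun tw : Site (d + 1) × Site (d + 1) => p (tw.1 γ) * q (tw.2 α) * wilsonA d γ tw.1 tw.2 z (Sum.inl α) (Sum.inl b))
      (-(1 / 2 : ℝ) * curvAdj (fun κ l (x : Site (d + 1)) =>
        (if κ = γ ∧ l = α then p (x γ) * q (x α) else 0) - (if κ = α ∧ l = γ then p (x γ) * q (x α) else 0)) b z) := by
  rw [← edgeCurrent_eq_neg_half_curvAdj hγα p q b z]
  exact hasSum_biweighted_wilsonA hγα p q b z

/-- [folklore] **WEIGHTS ON (TABLE SITE, SECOND LEG), FIRST LEG FREE: MINUS THE EDGE CURRENT** (the table is antisymmetric under the exchange of its two legs: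
`wilsonA d γ t x z (inl a) (inl b) = −wilsonA d γ t z x (inl b) (inl a)`): `Σ'_{(t,w)} p(t_γ)·q(w_α)·wilsonA d γ t z w (inl b) (inl α) = +½·curvAdj (p ⊗ q) b z` — the
currency of the background-summed dressed half-vertex (`DressedHalfVertex.hasSum_vertexOfK_dressedStep`: face weight on the table site) read on its SECOND leg at the
`α`-exit face. -/
theorem hasSum_biweighted_wilsonA_snd (p q : ℤ → ℝ) (b : Fin (d + 1)) (z : Site (d + 1)) :
    HasSum (fun tw : Site (d + 1) × Site (d + 1) => p (tw.1 γ) * q (tw.2 α) * wilsonA d γ tw.1 z tw.2 (Sum.inl b) (Sum.inl α))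
      ((1 / 2 : ℝ) * curvAdj (fun κ l (x : Site (d + 1)) =>
        (if κ = γ ∧ l = α then p (x γ) * q (x α) else 0) - (if κ = α ∧ l = γ then p (x γ) * q (x α) else 0)) b z) := by
  have h := (hasSum_biweighted_wilsonA_curvAdj hγα p q b z).neg
  have e : ∀ tw : Site (d + 1) × Site (d + 1), p (tw.1 γ) * q (tw.2 α) * wilsonA d γ tw.1 z tw.2 (Sum.inl b) (Sum.inl α) =
      -(p (tw.1 γ) * q (tw.2 α) * wilsonA d γ tw.1 tw.2 z (Sum.inl α) (Sum.inl b)) := by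
    intro tw
    show p (tw.1 γ) * q (tw.2 α) * (1 / 2 * (StepJetData.wEntry d γ tw.1 z tw.2 b α - StepJetData.wEntry d γ tw.1 tw.2 z α b)) =
      -(p (tw.1 γ) * q (tw.2 α) * (1 / 2 * (StepJetData.wEntry d γ tw.1 tw.2 z α b - StepJetData.wEntry d γ tw.1 z tw.2 b α)))
    ring
  simp_rw [e]
  rwa [neg_mul, neg_neg] at h

end Current

end Summit.QuantumFields.BalabanUV.Beta.GAN24.WilsonFaceHalfVertex

end
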